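import Summits.BirchSwinnertonDyer.Rank1Residual.GaloisImage.KolyvaginPrimeFlagLevelOne
import Literature.NumberTheory.EllipticCurves.KuriharaNumberDeepInvariants
import Literature.NumberTheory.EllipticCurves.GoodReductionUnramifiedProofs
import Literature.NumberTheory.GaloisRepresentations.IntegralGaloisActionProofs
import Literature.NumberTheory.EllipticCurves.IsogenyFrobeniusTraceProofs
import Literature.NumberTheory.EllipticCurves.BSDSelmerCMPConverseMaximalOrderProofs
import Literature.NumberTheory.EllipticCurves.ModularityVersionApProofs
import Literature.NumberTheory.EllipticCurves.SkinnerUrban2014.PAdicUnitPeriodRatioProofs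
import Literature.NumberTheory.EllipticCurves.CMTorsionIrreducibleOrdinaryProofs
import Literature.NumberTheory.EllipticCurves.NonEisensteinPrimeOfSurjective
import HarnessLib

/-!
# Route `KimAtThreeKolyvagin` (rung W2): the `∂`-functionals of the Kurihara numbers are
# `ℚ`-ISOGENY INVARIANTS (cruxes 19075 / 19076 / 19077, hygiene gap «∀ W vs optimal datum W₀»)

Cell `bsd-addord`, seat `bsd-addord-kim3` (gen 9). TOOL FILE: theorems only (no definition, no named
fact, no `sorry`); it closes nothing and books nothing.

**The gap it addresses** (planner TARGET v6.24 E67 = reading of seat w2-c4): the three W2 cruxes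
`DeepLowerAtThree` / `DeepUpperAtThree` / `ShallowEqDeepAtTorsionFree` quantify over EVERY globally
minimal `W` with the `3`-adic tower onto, while every kernel rung of the cell (n1011's `(a′)` END road,
the Kato-stratum rungs `deepLower_{datum,optimal}_of_ports`, w2-c4's period lemmas) is stated for a
curve carrying an (optimal) modular parametrisation datum. This file and its companion
`KimAtThreeKolyvaginIsogenyTransport` prove that nothing is lost: the seven `∂`-functionals of
`(W, p, f)` — `kuriharaDivIndex`, `kuriharaPartial`, `kuriharaPartialInfty`, `kuriharaVanishingOrder`
(`KuriharaNumberInvariants`), `kuriharaPartialDeepAt`, `kuriharaPartialDeep`, `kuriharaPartialDeepInfty`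
(`KuriharaNumberDeepInvariants`) — take the SAME value on any two `ℚ`-isogenous globally minimal
elliptic curves `W ~ W'` with `E[p]` irreducible (any prime `p`; the cruxes use `p = 3`).

**Why.** The functionals see `W` only through the level sets `Kato.IsKolyvaginProduct W p k n`
(`ℓ ∤ N_E p`, `ℓ ≡ 1`, `a_ℓ ≡ ℓ + 1 (mod p^k)`) and the cyclicity flag `IsCyclicKolyvaginLevel W p n`
(`#Ẽ(𝔽_ℓ)[p] ≤ p`) — §1, an abstract congruence. For `W ~ W'`: the bad primes agree (*AEC* VII.7.2,
tree `IsIsogenous.hasGoodReductionAtPrime_iff`, with `ℓ ∣ N_E ⟺ bad`,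
`dvd_conductorNorm_iff_not_hasGoodReductionAtPrime` — NO conductor-invariance fact is needed),
`a_ℓ(W) = a_ℓ(W')` at good `ℓ` (tree `frobeniusTrace_eq_of_isIsogenous`), and
`#Ẽ(𝔽_ℓ)[p] = #Ẽ'(𝔽_ℓ)[p]` at good `ℓ ≠ p` because both count the fixed points of a Frobenius at `ℓ`
on `E[p] ≅ E'[p]` (*AEC* VII.3.1(b) / VII.4.1(a), tree `FrobShape.exists_frobenius_natCard_fixed_eq`),
the `Γ_ℚ`-equivariant `E[p^j] ≅ E'[p^j]` being the restriction of an isogeny of degree prime to `p`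
(*AEC* III.4.11, tree `SkinnerUrban2014.exists_isogeny_not_dvd_degree_of_irreducible`) — §2–§4.

References: J. H. Silverman, *AEC* 2nd ed. (2009), III.4.11, III.6.4(b), Ex. 5.4, VII.3.1(b),
VII.4.1(a), VII.7.2 [SilvermanAEC2009]; C.-H. Kim, Amer. J. Math. 148 (2026) §1.2.2, §1.5.1
[Kim2022StructureSelmer]; B. Mazur, K. Rubin, Mem. AMS 799 (2004) Def. 4.5.7 [MazurRubin2004];
cell memo `run/shared/lean/pub/bsd-addord/kim3/KIM3-PROOF.md` §1.
-/

-- the Theorems namespace of a single-conjunct summit repeats the summit name by design (D-0017)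
set_option linter.dupNamespace false

noncomputable section

open scoped Classical NumberField MatrixGroups ModularForm
open Function Field NumberField IsDedekindDomain IsDedekindDomain.HeightOneSpectrum WeierstrassCurve
open CongruenceSubgroup
open Literature.NumberTheory.EllipticCurves Literature.NumberTheory.GaloisRepresentations
open Rat.HeightOneSpectrum Summit.BirchSwinnertonDyer.Rank1Residual.GaloisImage

namespace Summit.BirchSwinnertonDyer.BirchSwinnertonDyer.Theorems.KimAtThreeKolyvaginIsogenyInvariance

/-! ### §1 Abstract congruence: the functionals see `W` only through `𝒩_k` and the cyclicity flag -/

section Congruence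

variable {W W' : WeierstrassCurve ℚ} [W.IsGloballyMinimal] [W'.IsGloballyMinimal] {p : ℕ} {N : ℕ}
  (f : CuspForm (Gamma0 N) 2)
  (hP : ∀ k n : ℕ, Kato.IsKolyvaginProduct W p k n ↔ Kato.IsKolyvaginProduct W' p k n)

include hP

/-- `δ̃_n ∈ p^j ℤ_p/I_n` is the same condition for `W` and `W'` once `𝒩_k(W) = 𝒩_k(W')` for all `k`
(the Kurihara number itself is a datum of `f`). [cite: Kim2022StructureSelmer, §1.5.1 (PDF p. 7)] -/
theorem kuriharaDivisibleAt_iff (n j : ℕ) :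
    KuriharaDivisibleAt W p f n j ↔ KuriharaDivisibleAt W' p f n j := by
  exact ⟨fun h k hk hkn ψ hψ => h k hk ((hP k n).mpr hkn) ψ hψ,
    fun h k hk hkn ψ hψ => h k hk ((hP k n).mp hkn) ψ hψ⟩

/-- The divisibility index `kuriharaDivIndex` agrees. [cite: Kim2022StructureSelmer, Def. 2.13 (PDF p. 14)] -/
theorem kuriharaDivIndex_eq (n : ℕ) : kuriharaDivIndex W p f n = kuriharaDivIndex W' p f n := by
  rw [kuriharaDivIndex_def, kuriharaDivIndex_def]
  exact iSup_congr fun j => iSup_congr_Prop (kuriharaDivisibleAt_iff f hP n j) fun _ => rfl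

variable (hC : ∀ n : ℕ, IsCyclicKolyvaginLevel W p n ↔ IsCyclicKolyvaginLevel W' p n)

include hC

/-- `∂^{(i)}` agrees. [cite: Kim2022StructureSelmer, Def. 2.13 (PDF p. 14)] -/
theorem kuriharaPartial_eq (i : ℕ) : kuriharaPartial W p f i = kuriharaPartial W' p f i := by
  rw [kuriharaPartial_def, kuriharaPartial_def]
  exact iInf_congr fun n => iInf_congr_Prop (hC n) fun _ =>
    iInf_congr fun _ => kuriharaDivIndex_eq f hP n

/-- `∂^{(∞)}` agrees. [cite: Kim2022StructureSelmer, §1.5.1 (PDF p. 7)] -/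
theorem kuriharaPartialInfty_eq : kuriharaPartialInfty W p f = kuriharaPartialInfty W' p f := by
  unfold kuriharaPartialInfty
  exact iInf_congr fun i => kuriharaPartial_eq f hP hC i

/-- `ord(δ̃)` agrees. [cite: Kim2022StructureSelmer, §1.4.4 (PDF p. 7)] -/
theorem kuriharaVanishingOrder_eq : kuriharaVanishingOrder W p f = kuriharaVanishingOrder W' p f := by
  unfold kuriharaVanishingOrder
  exact iInf_congr fun n => iInf_congr_Prop (hC n) fun _ => by rw [kuriharaDivIndex_eq f hP n]

/-- The level-`k` deep invariant `∂^{(i)}(δ̃^{(k)})` agrees. [cite: MazurRubin2004, Def. 4.5.7] -/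
theorem kuriharaPartialDeepAt_eq (k i : ℕ) :
    kuriharaPartialDeepAt W p f k i = kuriharaPartialDeepAt W' p f k i := by
  rw [kuriharaPartialDeepAt_def, kuriharaPartialDeepAt_def]
  exact iInf_congr fun n => iInf_congr_Prop (hC n) fun _ => iInf_congr_Prop (hP k n) fun _ =>
    iInf_congr fun _ => by rw [kuriharaDivIndex_eq f hP n]

/-- `∂^{(i)}_{deep}` agrees. [cite: MazurRubin2004, Def. 5.2.11] -/
theorem kuriharaPartialDeep_eq (i : ℕ) : kuriharaPartialDeep W p f i = kuriharaPartialDeep W' p f i := by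
  unfold kuriharaPartialDeep
  exact iSup_congr fun k => kuriharaPartialDeepAt_eq f hP hC k i

/-- `∂^{(∞)}_{deep}` agrees. [cite: MazurRubin2004, Def. 5.2.11] -/
theorem kuriharaPartialDeepInfty_eq :
    kuriharaPartialDeepInfty W p f = kuriharaPartialDeepInfty W' p f := by
  unfold kuriharaPartialDeepInfty
  exact iInf_congr fun i => kuriharaPartialDeep_eq f hP hC i

end Congruence

/-! ### §2 Isogenous curves have the same Kolyvagin primes `𝒫_k` and levels `𝒩_k` -/

section Levels

variable {W W' : WeierstrassCurve ℚ} [W.IsElliptic] [W'.IsElliptic] [W.IsGloballyMinimal]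
  [W'.IsGloballyMinimal]

/-- A Kolyvagin prime of level `k` for `W` is one for any `ℚ`-isogenous `W'`: `ℓ ∤ N_E` means good
reduction at `ℓ` (tree `dvd_conductorNorm_iff_not_hasGoodReductionAtPrime`), an isogeny invariant
(*AEC* VII.7.2), and then `a_ℓ(W) = a_ℓ(W')` (*AEC* Ex. 5.4(a)). [cite: SilvermanAEC2009, Cor. VII.7.2 and Ex. 5.4(a)] -/
theorem isKolyvaginPrime_of_isIsogenous (hiso : IsIsogenous W W') {p k ℓ : ℕ}
    (h : Kato.IsKolyvaginPrime W p k ℓ) : Kato.IsKolyvaginPrime W' p k ℓ := by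
  obtain ⟨hℓ, hnd, h1, ha⟩ := h
  haveI := Fact.mk hℓ
  have hgood : W.HasGoodReductionAtPrime ℓ := by
    by_contra hbad
    exact hnd (((dvd_conductorNorm_iff_not_hasGoodReductionAtPrime (W := W) ℓ).mpr hbad).mul_right p)
  have hgood' : W'.HasGoodReductionAtPrime ℓ := (hiso.hasGoodReductionAtPrime_iff ℓ).mp hgood
  refine ⟨hℓ, ?_, h1, ?_⟩
  · intro hd
    rcases (Nat.Prime.dvd_mul hℓ).mp hd with hN | hp
    · exact ((dvd_conductorNorm_iff_not_hasGoodReductionAtPrime (W := W') ℓ).mp hN) hgood'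
    · exact hnd (Dvd.dvd.mul_left hp _)
  · rwa [← frobeniusTrace_eq_of_isIsogenous hiso ℓ hgood hgood']

/-- `𝒫_k(W) = 𝒫_k(W')` for `ℚ`-isogenous globally minimal elliptic curves. [cite: SilvermanAEC2009, Cor. VII.7.2 and Ex. 5.4(a)] -/
theorem isKolyvaginPrime_iff_of_isIsogenous (hiso : IsIsogenous W W') (p k ℓ : ℕ) :
    Kato.IsKolyvaginPrime W p k ℓ ↔ Kato.IsKolyvaginPrime W' p k ℓ :=
  ⟨isKolyvaginPrime_of_isIsogenous hiso, isKolyvaginPrime_of_isIsogenous hiso.symm_of_charZero⟩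

/-- `𝒩_k(W) = 𝒩_k(W')` for `ℚ`-isogenous globally minimal elliptic curves. [cite: Kim2022StructureSelmer, §1.2.2] -/
theorem isKolyvaginProduct_iff_of_isIsogenous (hiso : IsIsogenous W W') (p k n : ℕ) :
    Kato.IsKolyvaginProduct W p k n ↔ Kato.IsKolyvaginProduct W' p k n := by
  unfold Kato.IsKolyvaginProduct
  exact and_congr_right fun _ => forall₂_congr fun ℓ _ => isKolyvaginPrime_iff_of_isIsogenous hiso p k ℓ

end Levels

/-! ### §3 The cyclicity flag `#Ẽ(𝔽_ℓ)[p]` along a `Γ_ℚ`-equivariant `E[p] ≅ E'[p]` -/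

section Flag

variable {W W' : WeierstrassCurve ℚ} [W.IsElliptic] [W'.IsElliptic] [W.IsGloballyMinimal]
  [W'.IsGloballyMinimal] {p : ℕ} [Fact p.Prime]

omit [W.IsElliptic] [W'.IsElliptic] [W.IsGloballyMinimal] [W'.IsGloballyMinimal] [Fact p.Prime] in
/-- Fixed points of one `σ ∈ Γ_ℚ` on `E[p]` and on `E'[p]` correspond under an equivariant
isomorphism `E[p] ≅ E'[p]`. [folklore] -/
theorem natCard_fixed_eq_of_torsionAddEquiv (e : geomTorsion W (p : ℤ) ≃+ geomTorsion W' (p : ℤ))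
    (he : ∀ (σ : absoluteGaloisGroup ℚ) (P : geomTorsion W (p : ℤ)), e (σ • P) = σ • e P)
    (σ : absoluteGaloisGroup ℚ) :
    Nat.card {P : geomTorsion W (p : ℤ) // σ • P = P} =
      Nat.card {Q : geomTorsion W' (p : ℤ) // σ • Q = Q} := by
  refine Nat.card_congr
    { toFun := fun P => ⟨e P.1, by rw [← he, P.2]⟩
      invFun := fun Q => ⟨e.symm Q.1, e.injective (by rw [he, e.apply_symm_apply]; exact Q.2)⟩
      left_inv := fun P => Subtype.ext (e.symm_apply_apply P.1)
      right_inv := fun Q => Subtype.ext (e.apply_symm_apply Q.1) }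

/-- **`#Ẽ(𝔽_ℓ)[p] = #Ẽ'(𝔽_ℓ)[p]` at a good prime `ℓ ≠ p` for `ℚ`-isogenous curves with `E[p] ≅ E'[p]`
equivariantly** (reductions mod `ℓ` of the two global minimal models): each side counts the fixed
points of an arithmetic Frobenius at `ℓ` on the `p`-torsion (*AEC* VII.3.1(b), tree
`FrobShape.exists_frobenius_natCard_fixed_eq`); two Frobenii above `ℓ` are conjugate up to inertia,
trivial on `E'[p]` at a good `ℓ ∤ p` (VII.4.1(a)). [cite: SilvermanAEC2009, Prop. VII.3.1(b) and Prop. VII.4.1(a)] -/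
theorem natCard_torsion_intModel_eq_of_torsionAddEquiv (hiso : IsIsogenous W W')
    (e : geomTorsion W (p : ℤ) ≃+ geomTorsion W' (p : ℤ))
    (he : ∀ (σ : absoluteGaloisGroup ℚ) (P : geomTorsion W (p : ℤ)), e (σ • P) = σ • e P)
    {ℓ : ℕ} [Fact ℓ.Prime] (hℓp : ℓ ≠ p) (hgood : W.HasGoodReductionAtPrime ℓ) :
    Nat.card {P : ((integralModelInt W).map (Int.castRingHom (ZMod ℓ))).toAffine.Point // p • P = 0} =
      Nat.card {P : ((integralModelInt W').map (Int.castRingHom (ZMod ℓ))).toAffine.Point //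
        p • P = 0} := by
  have hp : p.Prime := Fact.out
  obtain ⟨v, hvℓ⟩ : ∃ v : HeightOneSpectrum (𝓞 ℚ), (primesEquiv v : ℕ) = ℓ :=
    ⟨primesEquiv.symm ⟨ℓ, Fact.out⟩, by rw [Equiv.apply_symm_apply]⟩
  have hv : (ℓ : 𝓞 ℚ) ∈ v.asIdeal := KolyvaginPrime.natCast_mem_asIdeal_of_primesEquiv_eq hvℓ
  have hgood' : W'.HasGoodReductionAtPrime ℓ := (hiso.hasGoodReductionAtPrime_iff ℓ).mp hgood
  have hgoodv' : W'.HasGoodReductionAt v :=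
    (hasGoodReductionAtPrime_primesEquiv_iff_holds W' v ℓ hvℓ).mp hgood'
  -- Frobenius data on both curves
  obtain ⟨σ₀, 𝔓₀, h𝔓₀, hσ₀, hcount⟩ := FrobShape.exists_frobenius_natCard_fixed_eq W p ℓ hℓp hgood hv
  obtain ⟨σ₁, 𝔓₁, h𝔓₁, hσ₁, hcount'⟩ :=
    FrobShape.exists_frobenius_natCard_fixed_eq W' p ℓ hℓp hgood' hv
  have hc := hcount 1; have hc' := hcount' 1
  rw [pow_one] at hc hc'
  rw [← KolyvaginPrime.natCard_torsionBy_reductionAt_eq' W hv p,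
    ← KolyvaginPrime.natCard_torsionBy_reductionAt_eq' W' hv p, ← hc, ← hc']
  -- move `σ₁` to the prime `𝔓₀`
  obtain ⟨g, hg⟩ := HeightOneSpectrum.exists_smul_eq_of_mem_primesAbove_holds h𝔓₁ h𝔓₀
  have hσ₁' : IsArithFrobAt (𝓞 ℚ) (g * σ₁ * g⁻¹) 𝔓₀ := hg ▸ hσ₁.conj g
  have hI := hσ₀.mul_inv_mem_inertia hσ₁'
  have hpv : (((p : ℕ) : ℤ) : 𝓞 ℚ) ∉ v.asIdeal := fun hmem => by
    rw [Int.cast_natCast] at hmem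
    exact hℓp ((primesEquiv_eq_of_natCast_mem hp hmem).symm.trans hvℓ).symm
  have hσσ : ∀ P : geomTorsion W' ((p : ℕ) : ℤ), σ₀ • P = (g * σ₁ * g⁻¹) • P := fun P => by
    have h := W'.smul_geomTorsion_eq_of_mem_inertia hgoodv' hpv h𝔓₀ hI ((g * σ₁ * g⁻¹) • P)
    rwa [mul_smul, inv_smul_smul] at h
  have hconj : Nat.card {P : geomTorsion W' ((p : ℕ) : ℤ) // σ₁ • P = P} =
      Nat.card {P : geomTorsion W' ((p : ℕ) : ℤ) // (g * σ₁ * g⁻¹) • P = P} := by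
    refine Nat.card_congr
      { toFun := fun P => ⟨g • P.1, by rw [mul_smul, mul_smul, inv_smul_smul, P.2]⟩
        invFun := fun Q => ⟨g⁻¹ • Q.1, by
          simpa only [mul_smul, smul_eq_iff_eq_inv_smul] using Q.2⟩
        left_inv := fun P => Subtype.ext (inv_smul_smul g P.1)
        right_inv := fun Q => Subtype.ext (smul_inv_smul g Q.1) }
  rw [natCard_fixed_eq_of_torsionAddEquiv e he σ₀, hconj]
  exact Nat.card_congr (Equiv.subtypeEquivRight fun P => by rw [hσσ P])

/-- **The cyclicity flag is an isogeny invariant**: for `ℚ`-isogenous globally minimal elliptic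
curves with `E[p] ≅ E'[p]` equivariantly, `n` is a cyclic Kolyvagin level for `W` iff for `W'`
(the prime factors of a level are good primes `≠ p`). [cite: Kim2022StructureSelmer, §1.2.2 and Thm. 2.1] -/
theorem isCyclicKolyvaginLevel_iff_of_torsionAddEquiv (hiso : IsIsogenous W W')
    (e : geomTorsion W (p : ℤ) ≃+ geomTorsion W' (p : ℤ))
    (he : ∀ (σ : absoluteGaloisGroup ℚ) (P : geomTorsion W (p : ℤ)), e (σ • P) = σ • e P)
    (n : ℕ) : IsCyclicKolyvaginLevel W p n ↔ IsCyclicKolyvaginLevel W' p n := by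
  unfold IsCyclicKolyvaginLevel
  rw [isKolyvaginProduct_iff_of_isIsogenous hiso p 1 n]
  refine and_congr_right fun hn => ?_
  refine forall_congr' fun ℓ => forall_congr' fun _ => forall_congr' fun hℓn => ?_
  have hK : Kato.IsKolyvaginPrime W p 1 ℓ := ((isKolyvaginProduct_iff_of_isIsogenous hiso p 1 n).mpr
    hn).2 ℓ (Nat.mem_primeFactors.mpr ⟨Fact.out, hℓn, hn.ne_zero⟩)
  have hgood : W.HasGoodReductionAtPrime ℓ := by
    by_contra hbad
    exact hK.not_dvd_conductorNorm
      ((dvd_conductorNorm_iff_not_hasGoodReductionAtPrime (W := W) ℓ).mpr hbad)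
  rw [natCard_torsion_intModel_eq_of_torsionAddEquiv hiso e he hK.ne hgood]

end Flag

/-! ### §4 An isogeny of degree prime to `m` restricts to `E[m] ≅ E'[m]`; supply from irreducibility -/

section TorsionIso

variable {W W' : WeierstrassCurve ℚ} [W.IsElliptic] [W'.IsElliptic]

/-- **Restriction of a prime-to-`m` isogeny to the `m`-torsion**: an isogeny `φ : E → E'` over `ℚ` of
degree prime to `m ≠ 0` restricts to a `Γ_ℚ`-equivariant `E[m] ≅ E'[m]` (injective: a point of
`ker φ ∩ E[m]` has order dividing `gcd(deg φ, m) = 1`; both sides have `m²` points, *AEC* III.6.4(b)).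
[cite: SilvermanAEC2009, Cor. III.6.4(b) and Cor. III.4.11] -/
theorem exists_torsionAddEquiv_of_coprime (φ : Isogeny W W') {m : ℕ} (hm : m ≠ 0)
    (hcop : Nat.Coprime φ.degree m) :
    ∃ e : geomTorsion W (m : ℤ) ≃+ geomTorsion W' (m : ℤ),
      (∀ (σ : absoluteGaloisGroup ℚ) (P : geomTorsion W (m : ℤ)), e (σ • P) = σ • e P) ∧
        ∀ P : geomTorsion W (m : ℤ), ((e P : geomTorsion W' (m : ℤ)) : W'.geomPoints) = φ P := by
  have hmem : ∀ P : geomTorsion W (m : ℤ), φ (P : W.geomPoints) ∈ geomTorsion W' (m : ℤ) := fun P => by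
    have hP : (m : ℤ) • (P : W.geomPoints) = 0 := (Submodule.mem_torsionBy_iff (m : ℤ) _).mp P.2
    refine (Submodule.mem_torsionBy_iff (m : ℤ) _).mpr ?_
    rw [← map_zsmul, hP, map_zero]
  let f : geomTorsion W (m : ℤ) →+ geomTorsion W' (m : ℤ) :=
    { toFun := fun P => ⟨φ P, hmem P⟩
      map_zero' := Subtype.ext (map_zero φ)
      map_add' := fun P Q => Subtype.ext (map_add φ (P : W.geomPoints) (Q : W.geomPoints)) }
  have hf : ∀ P, ((f P : geomTorsion W' (m : ℤ)) : W'.geomPoints) = φ P := fun P => rfl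
  -- injectivity
  have hinj : Function.Injective f := by
    rw [injective_iff_map_eq_zero]
    intro P hP
    have hker : (P : W.geomPoints) ∈ φ.toAddMonoidHom.ker := by
      rw [AddMonoidHom.mem_ker, Isogeny.coe_toAddMonoidHom]
      exact congrArg Subtype.val hP
    have h1 : addOrderOf (P : W.geomPoints) ∣ φ.degree :=
      AddSubgroup.addOrderOf_dvd_natCard φ.toAddMonoidHom.ker hker
    have h2 : addOrderOf (P : W.geomPoints) ∣ m := by
      refine addOrderOf_dvd_of_nsmul_eq_zero ?_
      have hP' : (m : ℤ) • (P : W.geomPoints) = 0 := (Submodule.mem_torsionBy_iff (m : ℤ) _).mp P.2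
      rwa [natCast_zsmul] at hP'
    have h3 : addOrderOf (P : W.geomPoints) = 1 := by
      have h := Nat.dvd_gcd h1 h2
      rw [Nat.Coprime.gcd_eq_one hcop] at h
      exact Nat.dvd_one.mp h
    exact Subtype.ext (AddMonoid.addOrderOf_eq_one_iff.mp h3)
  -- bijectivity by counting
  haveI : Finite (geomTorsion W' (m : ℤ)) :=
    finite_torsionPoints_holds W' (AlgebraicClosure ℚ) (by exact_mod_cast hm)
  have hcard : Nat.card (geomTorsion W' (m : ℤ)) ≤ Nat.card (geomTorsion W (m : ℤ)) := by
    rw [W.natCard_geomTorsion_natCast hm, W'.natCard_geomTorsion_natCast hm]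
  refine ⟨AddEquiv.ofBijective f (hinj.bijective_of_nat_card_le hcard), fun σ P => ?_, fun P => rfl⟩
  apply Subtype.ext
  change φ ((σ • P : geomTorsion W (m : ℤ)) : W.geomPoints) = ((σ • f P : geomTorsion W' (m : ℤ)) : W'.geomPoints)
  rw [AddSubgroup.torsionBy.coe_smul, φ.map_smul, AddSubgroup.torsionBy.coe_smul, hf]

/-- **`E[p^j] ≅ E'[p^j]` equivariantly, for every `j`, for `ℚ`-isogenous curves with `E[p]`
irreducible**: an isogeny out of a curve with irreducible `E[p]` may be taken of degree prime to `p`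
(*AEC* III.4.11; tree `SkinnerUrban2014.exists_isogeny_not_dvd_degree_of_irreducible`).
[cite: SilvermanAEC2009, Cor. III.4.11 and Cor. III.6.4(b)] -/
theorem exists_torsionAddEquiv_pow_of_irreducible {p : ℕ} [Fact p.Prime]
    (hirr : W.HasIrreducibleModPGaloisRep p) (hiso : IsIsogenous W W') (j : ℕ) :
    ∃ e : geomTorsion W ((p ^ j : ℕ) : ℤ) ≃+ geomTorsion W' ((p ^ j : ℕ) : ℤ),
      ∀ (σ : absoluteGaloisGroup ℚ) (P : geomTorsion W ((p ^ j : ℕ) : ℤ)), e (σ • P) = σ • e P := by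
  have hp : p.Prime := Fact.out
  obtain ⟨ψ, hψ⟩ := SkinnerUrban2014.exists_isogeny_not_dvd_degree_of_irreducible
    (W := W) (W' := W') (Nat.cast_ne_zero.mpr hp.ne_zero) hirr hiso
  obtain ⟨e, he, -⟩ := exists_torsionAddEquiv_of_coprime ψ (pow_ne_zero j hp.ne_zero)
    (Nat.Coprime.pow_right j ((Nat.Prime.coprime_iff_not_dvd hp).mpr hψ).symm)
  exact ⟨e, he⟩

/-- The case `j = 1`: `E[p] ≅ E'[p]` equivariantly. [cite: SilvermanAEC2009, Cor. III.4.11] -/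
theorem exists_torsionAddEquiv_of_irreducible {p : ℕ} [Fact p.Prime]
    (hirr : W.HasIrreducibleModPGaloisRep p) (hiso : IsIsogenous W W') :
    ∃ e : geomTorsion W (p : ℤ) ≃+ geomTorsion W' (p : ℤ),
      ∀ (σ : absoluteGaloisGroup ℚ) (P : geomTorsion W (p : ℤ)), e (σ • P) = σ • e P := by
  have h := exists_torsionAddEquiv_pow_of_irreducible hirr hiso 1
  rwa [pow_one] at h

end TorsionIso

/-! ### §5 The seven functionals are isogeny invariants -/

section Main

variable {W W' : WeierstrassCurve ℚ} [W.IsElliptic] [W'.IsElliptic] [W.IsGloballyMinimal]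
  [W'.IsGloballyMinimal] {p : ℕ} [Fact p.Prime] {N : ℕ} (f : CuspForm (Gamma0 N) 2)
  (hiso : IsIsogenous W W') (hirr : W.HasIrreducibleModPGaloisRep p)

include hiso hirr in
/-- The cyclic Kolyvagin levels of `ℚ`-isogenous curves with `E[p]` irreducible coincide.
[cite: Kim2022StructureSelmer, §1.2.2 and Thm. 2.1] -/
theorem isCyclicKolyvaginLevel_iff_of_isIsogenous (n : ℕ) :
    IsCyclicKolyvaginLevel W p n ↔ IsCyclicKolyvaginLevel W' p n := by
  obtain ⟨e, he⟩ := exists_torsionAddEquiv_of_irreducible hirr hiso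
  exact isCyclicKolyvaginLevel_iff_of_torsionAddEquiv hiso e he n

include hiso in
omit [Fact p.Prime] in
/-- **`kuriharaDivIndex` is a `ℚ`-isogeny invariant** (globally minimal elliptic `W ~ W'`; no image
hypothesis; any cusp form `f`). [cite: Kim2022StructureSelmer, Def. 2.13 (PDF p. 14)] -/
theorem kuriharaDivIndex_eq_of_isIsogenous (n : ℕ) :
    kuriharaDivIndex W p f n = kuriharaDivIndex W' p f n :=
  kuriharaDivIndex_eq f (isKolyvaginProduct_iff_of_isIsogenous hiso p) n

include hiso hirr

/-- **`∂^{(i)}` is a `ℚ`-isogeny invariant.** [cite: Kim2022StructureSelmer, Def. 2.13 (PDF p. 14)] -/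
theorem kuriharaPartial_eq_of_isIsogenous (i : ℕ) : kuriharaPartial W p f i = kuriharaPartial W' p f i :=
  kuriharaPartial_eq f (isKolyvaginProduct_iff_of_isIsogenous hiso p)
    (isCyclicKolyvaginLevel_iff_of_isIsogenous hiso hirr) i

/-- **`∂^{(∞)}` is a `ℚ`-isogeny invariant.** [cite: Kim2022StructureSelmer, §1.5.1 (PDF p. 7)] -/
theorem kuriharaPartialInfty_eq_of_isIsogenous :
    kuriharaPartialInfty W p f = kuriharaPartialInfty W' p f :=
  kuriharaPartialInfty_eq f (isKolyvaginProduct_iff_of_isIsogenous hiso p)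
    (isCyclicKolyvaginLevel_iff_of_isIsogenous hiso hirr)

/-- **`ord(δ̃)` is a `ℚ`-isogeny invariant.** [cite: Kim2022StructureSelmer, §1.4.4 (PDF p. 7)] -/
theorem kuriharaVanishingOrder_eq_of_isIsogenous :
    kuriharaVanishingOrder W p f = kuriharaVanishingOrder W' p f :=
  kuriharaVanishingOrder_eq f (isKolyvaginProduct_iff_of_isIsogenous hiso p)
    (isCyclicKolyvaginLevel_iff_of_isIsogenous hiso hirr)

/-- **`∂^{(i)}(δ̃^{(k)})` is a `ℚ`-isogeny invariant.** [cite: MazurRubin2004, Def. 4.5.7] -/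
theorem kuriharaPartialDeepAt_eq_of_isIsogenous (k i : ℕ) :
    kuriharaPartialDeepAt W p f k i = kuriharaPartialDeepAt W' p f k i :=
  kuriharaPartialDeepAt_eq f (isKolyvaginProduct_iff_of_isIsogenous hiso p)
    (isCyclicKolyvaginLevel_iff_of_isIsogenous hiso hirr) k i

/-- **`∂^{(i)}_{deep}` is a `ℚ`-isogeny invariant.** [cite: MazurRubin2004, Def. 5.2.11] -/
theorem kuriharaPartialDeep_eq_of_isIsogenous (i : ℕ) :
    kuriharaPartialDeep W p f i = kuriharaPartialDeep W' p f i :=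
  kuriharaPartialDeep_eq f (isKolyvaginProduct_iff_of_isIsogenous hiso p)
    (isCyclicKolyvaginLevel_iff_of_isIsogenous hiso hirr) i

/-- **`∂^{(∞)}_{deep}` is a `ℚ`-isogeny invariant.** [cite: MazurRubin2004, Def. 5.2.11] -/
theorem kuriharaPartialDeepInfty_eq_of_isIsogenous :
    kuriharaPartialDeepInfty W p f = kuriharaPartialDeepInfty W' p f :=
  kuriharaPartialDeepInfty_eq f (isKolyvaginProduct_iff_of_isIsogenous hiso p)
    (isCyclicKolyvaginLevel_iff_of_isIsogenous hiso hirr)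

end Main

end Summit.BirchSwinnertonDyer.BirchSwinnertonDyer.Theorems.KimAtThreeKolyvaginIsogenyInvariance

end
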